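import Summits.PneNP.PneNP.Theorems.SymmetryBudgetWindowCanoniserWiringDefs

/-!
# Window canoniser, IV′: children, main-atom builders and formula formers (definitions)

Route `PneNP/SymmetryBudget`, dichotomy `WindowBarrier` (stmt-PneNP-2145) / `NoHiddenOrder` (stmt-PneNP-14781);
continuation of `…WindowCanoniserWiringDefs.lean`.  The argument wires of the MAIN atoms of a label `L = (U, X, λ)`,
computed on the final replay state (iteration `T n`):

* colour ranks `rkGE` (`#{w' ∈ W : c w' < c w} ≥ j`);
* CERTIFICATION of a child — a candidate `(x, h)` (label `L.cand x h`, admissible, `x ∉ X`) or a part `U'`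
  (label `L.part U'`, `∅ ≠ U' ⊂ U`): `mtch ch it` (the child's replay state at `it` equals mine at `T`),
  `thru ch` (at some iteration the child passed, unfrozen, through my state — and, for a candidate, selected `x`
  there), `cert ch` (through, arrived, alive, and reporting a value);
* LIFTING a candidate's value: `pcand`/`lcrk` (its colour ranks re-expressed in my colouring), the value bit `lbitA`;
* CHOICE: `pfx`/`lexLE` (lexicographic comparison of lifted value vectors), `best` (certified and least), `ivbit`
  (the value bits at an individualisation node), `inonbot`;
* PARTS (section node): `isP u U'` (`U'` is the component of `u`), `pcov`/`pnonbot` (every component certified),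
  `pbit`/`rkInGE`/`pcP`/`ppc`/`pcrk` (a component's value bits and colours re-expressed in my colouring),
  `ppfx`/`plexLT` (comparison of part vectors: size one-hot then value), `pstGE`/`pbcGE` (start and size of the block
  of equal parts), `pat p u i o` (position `p` is offset `o` of the `i`-th part of the block of `u`), `off`, `blkI`,
  `samePart`, `spc` (the colour at a position), and the pasted value bits `svadj`/`svext`/`svcrk` (inside a part:
  copied; across parts: the switch bit of the two colours, `CGCanon.adj_iff_switch_of_not_adj`);
* the VALUE BIT `vbit b` of the group (leaf: static; else by connectivity of the final state).
Here: the index encoders, child labels, the builders of the main atoms and the formula formers used by the main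
wiring; the wiring itself (`Kind.argsM`, `Atom.args`, `Node.args`) is in `…WiringMainDefs.lean`.
-/

-- `Summit.PneNP.PneNP.…` duplicates `PneNP` BY DESIGN (single-problem summit, D-0017 layout).
set_option linter.dupNamespace false

noncomputable section

namespace Summit.PneNP.PneNP.Theorems

namespace WCan

open Finset Equiv Literature.Computability.Complexity

variable {K r n : ℕ}

/-! ### Index encoders -/

/-- Encoding a value-bit meaning as an index (inverse of `bdec`). -/
def benc {r n : ℕ} : BIdx r n → Fin (NB r n)
  | .adj p q => finSumFinEquiv (Sum.inl (finSumFinEquiv (Sum.inl (finProdFinEquiv (p, q)))))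
  | .ext p o => finSumFinEquiv (Sum.inl (finSumFinEquiv (Sum.inr (finProdFinEquiv (p, o)))))
  | .crk p j => finSumFinEquiv (Sum.inr (finProdFinEquiv (p, j)))

/-- The part-vector index of the size bit `s`. -/
def bpSize {r n : ℕ} (s : Fin (n + 1)) : Fin (NBp r n) := finSumFinEquiv (Sum.inl s)

/-- The part-vector index of the value bit `b`. -/
def bpVal {r n : ℕ} (b : Fin (NB r n)) : Fin (NBp r n) := finSumFinEquiv (Sum.inr b)

/-- A fixed enumeration of the vertex subsets (`|Finset (Fin n)| = 2^n`). -/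
def fsEnum (n : ℕ) : Fin (2 ^ n) ≃ Finset (Fin n) :=
  (finCongr (by rw [Fintype.card_finset, Fintype.card_fin])).trans (Fintype.equivFin (Finset (Fin n))).symm

/-- The two kinds of CHILDREN a group reads: a candidate `(x, h)` or a part `U'`. -/
abbrev Ch (n : ℕ) : Type := (Fin n × Fin (n + 1)) ⊕ Finset (Fin n)

section Builders

variable [NeZero n] (L : Lab K n)

/-- The candidate child label `L.cand x h`, if `x` is fresh and the label is admissible. -/
def candLab (x : Fin n) (h : Fin (n + 1)) : Option (Lab K n) :=
  if hx : x ∉ L.1.X ∧ L.1.cand x h ∈ RawLab.admSet K n then some ⟨L.1.cand x h, hx.2⟩ else none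

/-- The part child label `L.part U'`, if `∅ ≠ U' ⊂ U`. -/
def partLab (U' : Finset (Fin n)) : Option (Lab K n) :=
  if U' ⊂ L.1.U ∧ U'.Nonempty then some ⟨L.1.part U', RawLab.part_mem_admSet L.2 U'⟩ else none

/-- The child label read through the child slots of a parameter record. -/
def chLab (P : Prm r n) : Option (Lab K n) := if P.fl then partLab L P.us else candLab L (P.vs 0) P.h1

/-- Parameter record addressing the child `ch` (ambient vertex `z`, and an iteration). -/
def prmCh (ch : Ch n) (z : Fin n) (it : Fin (T n + 1) := 0) : Prm r n :=
  match ch with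
  | Sum.inl (x, h) => prm (vec1 x) (it := it) (h1 := h)
  | Sum.inr U' => prm (vec1 z) (it := it) (us := U') (fl := true)

/-- `rkGE w j`. -/
def aRkGE (w : Fin n) (j : Fin (n + 1)) : Atom K r n := .lab L .rkGE (prm (vec1 w) (s := j))
/-- `mtch ch it`. -/
def aMtch (ch : Ch n) (z : Fin n) (it : Fin (T n + 1)) : Atom K r n := .lab L .mtch (prmCh ch z it)
/-- `thru ch`. -/
def aThru (ch : Ch n) (z : Fin n) : Atom K r n := .lab L .thru (prmCh ch z)
/-- `cert ch`. -/
def aCert (ch : Ch n) (z : Fin n) : Atom K r n := .lab L .cert (prmCh ch z)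
/-- `pcand κ p w`. -/
def aPcand (κ : Fin n × Fin (n + 1)) (p w : Fin n) : Atom K r n :=
  .lab L .pcand (prm (vec2 κ.1 w) (h1 := κ.2) (ns := nvec1 p))
/-- `lcrk κ p j`. -/
def aLcrk (κ : Fin n × Fin (n + 1)) (p j : Fin n) : Atom K r n :=
  .lab L .lcrk (prm (vec1 κ.1) (h1 := κ.2) (ns := nvec2 p j))
/-- `pfx κ κ' t`. -/
def aPfx (κ κ' : Fin n × Fin (n + 1)) (t : Fin (NB r n + 1)) : Atom K r n :=
  .lab L .pfx (prm (vec2 κ.1 κ'.1) (h1 := κ.2) (h2 := κ'.2) (b := t))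
/-- `lexLE κ κ'`. -/
def aLexLE (κ κ' : Fin n × Fin (n + 1)) : Atom K r n := .lab L .lexLE (prm (vec2 κ.1 κ'.1) (h1 := κ.2) (h2 := κ'.2))
/-- `best κ`. -/
def aBest (κ : Fin n × Fin (n + 1)) : Atom K r n := .lab L .best (prm (vec1 κ.1) (h1 := κ.2))
/-- `ivbit b` (ambient vertex `z`). -/
def aIvbit (z : Fin n) (b : Fin (NB r n)) : Atom K r n := .lab L .ivbit (prm (vec1 z) (b := b.castSucc))
/-- `inonbot`. -/
def aInonbot (z : Fin n) : Atom K r n := .lab L .inonbot (prm (vec1 z))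
/-- `isP u U'`. -/
def aIsP (u : Fin n) (U' : Finset (Fin n)) : Atom K r n := .lab L .isP (prm (vec1 u) (us := U'))
/-- `pcov u`. -/
def aPcov (u : Fin n) : Atom K r n := .lab L .pcov (prm (vec1 u))
/-- `pnonbot`. -/
def aPnonbot (z : Fin n) : Atom K r n := .lab L .pnonbot (prm (vec1 z))
/-- `pbit u i`. -/
def aPbit (u : Fin n) (i : Fin (NBp r n)) : Atom K r n := .lab L .pbit (prm (vec1 u) (bp := i.castSucc))
/-- `rkInGE U' w j`. -/
def aRkInGE (U' : Finset (Fin n)) (w : Fin n) (j : Fin (n + 1)) : Atom K r n :=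
  .lab L .rkInGE (prm (vec1 w) (s := j) (us := U'))
/-- `pcP U' p w`. -/
def aPcP (U' : Finset (Fin n)) (p w : Fin n) : Atom K r n := .lab L .pcP (prm (vec1 w) (ns := nvec1 p) (us := U'))
/-- `ppc u p w`. -/
def aPpc (u p w : Fin n) : Atom K r n := .lab L .ppc (prm (vec2 u w) (ns := nvec1 p))
/-- `pcrk u p j`. -/
def aPcrk (u p j : Fin n) : Atom K r n := .lab L .pcrk (prm (vec1 u) (ns := nvec2 p j))
/-- `ppfx u u' t`. -/
def aPpfx (u u' : Fin n) (t : Fin (NBp r n + 1)) : Atom K r n := .lab L .ppfx (prm (vec2 u u') (bp := t))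
/-- `plexLT u u'`. -/
def aPlexLT (u u' : Fin n) : Atom K r n := .lab L .plexLT (prm (vec2 u u'))
/-- `plexEQ u u'`: the full prefix agreement. -/
def aPlexEQ (u u' : Fin n) : Atom K r n := aPpfx L u u' (Fin.last _)
/-- `pstGE u t`. -/
def aPstGE (u : Fin n) (t : Fin (n + 1)) : Atom K r n := .lab L .pstGE (prm (vec1 u) (s := t))
/-- `pbcGE u t`. -/
def aPbcGE (u : Fin n) (t : Fin (n + 1)) : Atom K r n := .lab L .pbcGE (prm (vec1 u) (s := t))
/-- `pat p u i o`. -/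
def aPat (p u i o : Fin n) : Atom K r n := .lab L .pat (prm (vec1 u) (ns := nvec3 p i o))
/-- `off p u o`. -/
def aOff (p u o : Fin n) : Atom K r n := .lab L .off (prm (vec1 u) (ns := nvec2 p o))
/-- `blkI p u i`. -/
def aBlkI (p u i : Fin n) : Atom K r n := .lab L .blkI (prm (vec1 u) (ns := nvec2 p i))
/-- `samePart p q` (ambient vertex `z`). -/
def aSamePart (p q z : Fin n) : Atom K r n := .lab L .samePart (prm (vec1 z) (ns := nvec2 p q))
/-- `spc p w`. -/
def aSpc (p w : Fin n) : Atom K r n := .lab L .spc (prm (vec1 w) (ns := nvec1 p))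
/-- `svadj p q` (ambient vertex `z`). -/
def aSvadj (p q z : Fin n) : Atom K r n := .lab L .svadj (prm (vec1 z) (ns := nvec2 p q))
/-- `svext p o` (ambient vertex `z`). -/
def aSvext (p : Fin n) (o : Fin r) (z : Fin n) : Atom K r n := .lab L .svext (prm (vec1 z) (ns := nvec1 p) (o1 := some o))
/-- `svcrk p j` (ambient vertex `z`). -/
def aSvcrk (p j z : Fin n) : Atom K r n := .lab L .svcrk (prm (vec1 z) (ns := nvec2 p j))
/-- `vbit b` (ambient vertex `z`). -/
def aVbit (z : Fin n) (b : Fin (NB r n)) : Atom K r n := .lab L .vbit (prm (vec1 z) (b := b.castSucc))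

/-- "the colour of `w` has rank `j`" in the final state of `Lx`, as a width-8 formula. -/
def rkF (Lx : Lab K n) (w j : Fin n) : N1 K r n := n1and [pos (aRkGE Lx w j.castSucc), neg (aRkGE Lx w j.succ)]

/-- The final replay state index. -/
abbrev tf (n : ℕ) : Fin (T n + 1) := Fin.last (T n)

/-- `¬(c a < c b) ∧ ¬(c b < c a)` in the final state: equal colours. -/
def EQF (Lx : Lab K n) (a b : Fin n) : N1 K r n := n1and [neg (aLT Lx (tf n) a b), neg (aLT Lx (tf n) b a)]

/-- "the group of `Lc` reports a value" (leaf: always; else by connectivity), as a width-4 formula. -/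
def nonbotF (Lc : Lab K n) (z : Fin n) : N2 K r n :=
  if Lc.1.U.card ≤ 1 then n2and []
  else n2or [n1and [pos (aConn Lc (tf n) z), pos (aInonbot Lc z)], n1and [neg (aConn Lc (tf n) z), pos (aPnonbot Lc z)]]

/-- The LIFTED value bit `i` of the candidate `κ`, as an atom: adjacency and outside bits are the child's own,
colour ranks are re-expressed in my colouring (`lcrk`). -/
def lbitA (κ : Fin n × Fin (n + 1)) (i : Fin (NB r n)) : Atom K r n :=
  match bdec i with
  | .crk p j => aLcrk L κ p j
  | _ => match candLab L κ.1 κ.2 with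
    | some Lc => aVbit Lc κ.1 i
    | none => ffA

/-- The part-vector bit `i` of the component of `u`, as an atom (colour ranks through `pcrk`). -/
def pvecA (u : Fin n) (i : Fin (NBp r n)) : Atom K r n :=
  match bpdec i with
  | Sum.inl _ => aPbit L u i
  | Sum.inr b => match bdec b with
    | .crk p j => aPcrk L u p j
    | _ => aPbit L u i

/-- The STATIC value bit `i` of a LEAF label (`|U| ≤ 1`): no adjacency; the outside bits of the single vertex at
position `0`; its colour has rank `0`. -/
def leafBitW (i : Fin (NB r n)) : Wire K r n :=
  if h : L.1.U.card = 1 then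
    let u₀ : Fin n := Classical.choose (Finset.card_eq_one.1 h)
    match bdec i with
    | .adj _ _ => wA ffA
    | .ext p o => if (p : ℕ) = 0 then wA (aExO u₀ o) else wA ffA
    | .crk p j => if (p : ℕ) = 0 ∧ (j : ℕ) = 0 then wA ttA else wA ffA
  else wA ffA

end Builders

end WCan

end Summit.PneNP.PneNP.Theorems

end
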